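import Summits.CriticalPhenomena.Ising3DConformalLimit.Theorems.LogPolarProxyProxyUniversalityReduction
import Literature.Probability.LatticeModels.CriticalScalingDimension
import HarnessLib

/-!
# Crux `ProxyUniversality` (stmt-CriticalPhenomena-11288), line `registered` — the LATTICE FORM:
# `ProxyUniversality ⟺ (a non-degenerate limit exists → proxy and cubic lattice agree in the pinned gauge)`

Route `LogPolarProxy`, sub-problem `Ising3DConformalLimit`; skeleton `Cruxes/ProxyUniversality/Lines/birth.lean`
(v4, continuation lead `prover-line-stmt-CriticalPhenomena-11288-c1-0`). The previous reduction
(`ProxyUniversality_iff_evenLimit`, `…Reduction.lean`) left ONE open statement S1' whose conclusion still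
speaks of a LIMIT OBJECT `S₀` (an unknown continuum family) in an arbitrary gauge `ρ₀`. This file strips
that last formal layer. Two devices:

* **the pinned (canonical lattice) gauge** `ρ_pin(δ) = ⟨σ₀ σ_{⌊1/δ⌋ e₀}⟩_{β_c}^{-1/2}` — written here as
  the closed term `fun δ => (criticalTwoPoint 3 (Pi.single 0 ⌊1/δ⌋)) ^ (-(1/2 : ℝ))`, which is VERBATIM
  the body of `Summit.CriticalPhenomena.Ising3DConformalLimit.MoebiusLimitExistsOnlyInteraction.rhoPin`
  (`Theorems/EnergyNotSigmaSquaredMoebiusLimitExistsDefs.lean`; every statement below becomes a statement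
  about `rhoPin` by `unfold rhoPin` — that module is deliberately NOT imported: its cone carries
  `GaussianPairingBoundCouplings`/`Sweep1`/`InterfaceSLE`, which the route's cone note (rev 2) asks
  Theorems files of `LogPolarProxy` to avoid). It is a function of the `ℤ³` model alone, positive at every
  mesh (two-point lower bound at `β_c`, tree theorem `criticalTwoPoint_bounds_holds`), and renormalises the
  reference pair `x₀ = (0, e₀)` to `1` EXACTLY at every mesh; if `criticalCorr 3` has a non-degenerate
  pointwise scaling limit in some gauge `(ρ, S)` then it has one in the pinned gauge, namely
  `S_pin n = (S 2 x₀)^{-n/2} · S n` (`hasPointwiseScalingLimit_pinnedGauge`; same shape as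
  `…ExistsScaleCovariantLimit/Negative/PinnedForm.lean`'s `hasPointwiseScalingLimit_rhoPin`);
* **the difference form** — along the proxy meshes `δ_N = π/(N+1)` the rescaled `ℤ³` correlators
  themselves converge to `S n` locally uniformly off the axis (restriction of the full-filter limit,
  `rescaledCorrelator_tendstoLocallyUniformlyOn_proxyMesh`), so "the renormalised proxy correlator
  converges to `S n`" is the same as "renormalised proxy correlator MINUS rescaled `ℤ³` correlator at the
  same mesh tends to `0`" (`tendstoLocallyUniformlyOn_proxyCorr_iff_sub`).

Result (`ProxyUniversality_iff_latticeForm`): the crux holds iff the EXISTENCE of a non-degenerate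
pointwise scaling limit of the critical `ℤ³` correlators implies the **lattice comparison**

  `LC_pin`: there are row-wise profiles `J_r, J_θ, J_φ ≥ 0` and amplitudes `A_N(θ) > 0` such that for
  every even `n ≠ 0`,
  `(∏ᵢ A_N(θᵢ) ρ_pin(δ_N‖pᵢ‖)) · ⟨∏ᵢ σ_{v_N(pᵢ)}⟩_{proxy,N} − ρ_pin(δ_N)ⁿ · ⟨∏ᵢ σ_{⌊pᵢ/δ_N⌋}⟩_{ℤ³,β_c} → 0`
  as `N → ∞`, locally uniformly on injective off-axis configurations `p`,

a statement about TWO LATTICE MODELS ONLY (no continuum family, no scaling dimension, no gauge freedom),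
and `LC_pin` alone already implies the crux (`ProxyUniversality_of_latticeComparison`) — it is the new
registered stub of the skeleton. Elementary limit algebra over Mathlib's `TendstoLocallyUniformlyOn`; no
definitions, no named facts.

References: R. C. Brower, G. T. Fleming, H. Neuberger, Phys. Lett. B 721 (2013) 299–305 (radial lattice
quantisation of 3D φ⁴/Ising) [BrowerFlemingNeuberger2013]; D. Chelkak, C. Hongler, K. Izyurov, Ann. Math.
181 (2015), Thm 1.1 (shape of renormalised lattice correlators) [ChelkakHonglerIzyurov2015];
H. Duminil-Copin, *Lectures on the Ising and Potts models on the hypercubic lattice* (2019), Thm 4.8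
(two-point bounds at `β_c`) [DuminilCopin2019].
-/

noncomputable section

namespace Summit.CriticalPhenomena.Ising3DConformalLimit.Cruxes.ProxyUniversality.Birth

open scoped BigOperators Topology
open Filter Set Function
open Literature.Probability.LatticeModels
open Summit.CriticalPhenomena.Ising3DConformalLimit.Theses.LogPolarProxy (ProxyUniversality)

/-! ## §1 Locally uniform convergence: change of index filter, the proxy meshes, the difference form -/

/-- Locally uniform convergence is preserved under composition of the INDEX with a map tending to the
index filter (e.g. restriction of a `δ → 0⁺` limit to a sequence of meshes). [folklore] -/
theorem tendstoLocallyUniformlyOn_comp_tendsto {α β ι κ : Type*} [TopologicalSpace α] [UniformSpace β]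
    {F : ι → α → β} {f : α → β} {p : Filter ι} {s : Set α} (h : TendstoLocallyUniformlyOn F f p s)
    {l : Filter κ} {g : κ → ι} (hg : Tendsto g l p) :
    TendstoLocallyUniformlyOn (fun k => F (g k)) f l s := fun u hu x hx =>
  let ⟨t, ht, hev⟩ := h u hu x hx
  ⟨t, ht, hg.eventually hev⟩

/-- The proxy mesh `δ_N = π/(N+1)` tends to `0⁺`. [folklore] -/
theorem tendsto_proxyMesh : Tendsto (fun N : ℕ => Real.pi / ((N : ℝ) + 1)) atTop (𝓝[>] (0:ℝ)) := by
  refine tendsto_nhdsWithin_iff.2 ⟨?_, Eventually.of_forall fun N => ?_⟩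
  · have h := tendsto_one_div_add_atTop_nhds_zero_nat.const_mul Real.pi
    rw [mul_zero] at h
    exact h.congr fun N => mul_one_div Real.pi ((N : ℝ) + 1)
  · exact div_pos Real.pi_pos (Nat.cast_add_one_pos _)

/-- **Restriction of a pointwise scaling limit to the proxy meshes, off the axis**: if `(ρ, S)` is a
pointwise scaling limit of the lattice family `G`, then along `δ_N = π/(N+1)` the rescaled correlators
`ρ(δ_N)ⁿ G n (⌊p/δ_N⌋)` converge to `S n` locally uniformly on `offAxis n ⊆ NonCoincident 3 n`.
[folklore; shape of ChelkakHonglerIzyurov2015 Thm 1.1] -/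
theorem rescaledCorrelator_tendstoLocallyUniformlyOn_proxyMesh {G : LatticeCorrFamily 3} {ρ : ℝ → ℝ}
    {S : CorrFamily 3} (hlim : HasPointwiseScalingLimit G ρ S) (n : ℕ) :
    TendstoLocallyUniformlyOn (fun N : ℕ => rescaledCorrelator G ρ n (Real.pi / ((N : ℝ) + 1))) (S n)
      atTop (offAxis n) :=
  (tendstoLocallyUniformlyOn_comp_tendsto (hlim n) tendsto_proxyMesh).mono
    (offAxis_subset_nonCoincident n)

/-- **Difference form of the realisation.** For a pointwise scaling limit `(ρ, S)` of `G`, fixed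
profiles, amplitudes and order `n`: the renormalised proxy correlators converge to `S n` locally
uniformly off the axis iff their DIFFERENCE with the rescaled lattice correlators at the same mesh
`δ_N` tends to `0` locally uniformly off the axis. [folklore] -/
theorem tendstoLocallyUniformlyOn_proxyCorr_iff_sub {Jr Jt Jp : ℕ → ℕ → ℝ} {A : ℕ → ℝ → ℝ}
    {ρ : ℝ → ℝ} {G : LatticeCorrFamily 3} {S : CorrFamily 3} (hlim : HasPointwiseScalingLimit G ρ S)
    (n : ℕ) :
    TendstoLocallyUniformlyOn (fun N : ℕ => proxyCorr Jr Jt Jp A ρ N n) (S n) atTop (offAxis n) ↔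
      TendstoLocallyUniformlyOn
        (fun (N : ℕ) (p : Fin n → EuclideanSpace ℝ (Fin 3)) =>
          proxyCorr Jr Jt Jp A ρ N n p - rescaledCorrelator G ρ n (Real.pi / ((N : ℝ) + 1)) p)
        (fun _ => 0) atTop (offAxis n) := by
  have hU := rescaledCorrelator_tendstoLocallyUniformlyOn_proxyMesh hlim n
  constructor
  · intro h
    refine ((h.sub hU).congr fun N p _ => rfl).congr_right fun p _ => ?_
    simp
  · intro h
    refine ((h.add hU).congr fun N p _ => ?_).congr_right fun p _ => ?_
    · simp
    · simp

/-! ## §2 The pinned gauge `ρ_pin(δ) = ⟨σ₀σ_{⌊1/δ⌋e₀}⟩_{β_c}^{-1/2}` (the body of `rhoPin`, inlined) -/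

/-- At mesh `δ` the reference pair `x₀ = (0, e₀)` sits on the lattice pair `(0, ⌊1/δ⌋ e₀)` (as a
`2`-configuration of sites). [folklore] -/
theorem latticeApprox_comp_refPair (δ : ℝ) :
    (fun i => latticeApprox δ ((![0, EuclideanSpace.single 0 1] : Fin 2 → EuclideanSpace ℝ (Fin 3)) i)) =
      ![(0 : Site 3), Pi.single 0 (⌊1 / δ⌋ : ℤ)] := by
  funext i
  fin_cases i
  · simp only [Fin.zero_eta, Matrix.cons_val_zero]
    exact latticeApprox_zero δ
  · simp only [Fin.mk_one, Matrix.cons_val_one, Matrix.cons_val_zero]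
    funext j
    rw [latticeApprox_apply, PiLp.single_apply]
    by_cases hj : j = 0
    · subst hj; simp
    · rw [if_neg hj, Pi.single_eq_of_ne hj, zero_div, Int.floor_zero]

/-- The axis two-point value under the pinned gauge is positive at EVERY mesh: `⟨σ₀σ_x⟩_{β_c} > 0` on
`ℤ³` (`= 1` at the origin, `twoPointPlus_zero`; two-point lower bound `c‖x‖^{-2} ≤ ⟨σ₀σ_x⟩_{β_c}` with
`c > 0` elsewhere, tree theorem `criticalTwoPoint_bounds_holds`). [cite: DuminilCopin2019, Thm. 4.8, §4.4] -/
theorem criticalTwoPoint_pinSite_pos (δ : ℝ) : 0 < criticalTwoPoint 3 (Pi.single 0 (⌊1 / δ⌋ : ℤ)) := by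
  set x : Site 3 := Pi.single 0 (⌊1 / δ⌋ : ℤ)
  by_cases hx : x = 0
  · rw [hx]
    show 0 < twoPointPlus 3 (criticalBeta 3) 0
    rw [twoPointPlus_zero]
    exact one_pos
  · obtain ⟨c, C, hc, hbd⟩ := criticalTwoPoint_bounds_holds (d := 3) (by norm_num)
    exact lt_of_lt_of_le (mul_pos hc (Real.rpow_pos_of_pos (norm_pos_iff.2 hx) _)) (hbd x hx).1

/-- **The pinned gauge is positive at every mesh** (a negative real power of a positive number).
[folklore] -/
theorem pinnedGauge_pos (δ : ℝ) :
    0 < (fun δ : ℝ => (criticalTwoPoint 3 (Pi.single 0 (⌊1 / δ⌋ : ℤ))) ^ (-(1 / 2 : ℝ))) δ :=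
  Real.rpow_pos_of_pos (criticalTwoPoint_pinSite_pos δ) _

/-- The pinned gauge is positive on `(0, 1]` (the form the crux asks of a renormalisation). [folklore] -/
theorem pinnedGauge_pos_Ioc : ∀ δ ∈ Set.Ioc (0:ℝ) 1,
    0 < (fun δ : ℝ => (criticalTwoPoint 3 (Pi.single 0 (⌊1 / δ⌋ : ℤ))) ^ (-(1 / 2 : ℝ))) δ :=
  fun δ _ => pinnedGauge_pos δ

/-- The square of the pinned gauge is the inverse axis two-point value: `ρ_pin(δ)² = ⟨σ₀σ_{⌊1/δ⌋e₀}⟩⁻¹`.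
[folklore] -/
theorem pinnedGauge_sq (δ : ℝ) :
    (fun δ : ℝ => (criticalTwoPoint 3 (Pi.single 0 (⌊1 / δ⌋ : ℤ))) ^ (-(1 / 2 : ℝ))) δ ^ 2 =
      (criticalTwoPoint 3 (Pi.single 0 (⌊1 / δ⌋ : ℤ)))⁻¹ := by
  show ((criticalTwoPoint 3 (Pi.single 0 (⌊1 / δ⌋ : ℤ))) ^ (-(1 / 2 : ℝ))) ^ 2 = _
  rw [← Real.rpow_natCast, ← Real.rpow_mul (criticalTwoPoint_pinSite_pos δ).le]
  norm_num
  exact Real.rpow_neg_one _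

/-- **The pinned gauge renormalises the reference pair to `1` exactly, at every mesh**:
`ρ_pin(δ)² · ⟨σ₀σ_{⌊1/δ⌋e₀}⟩_{β_c} = 1`. [folklore] -/
theorem rescaledCorrelator_pinnedGauge_refPair (δ : ℝ) :
    rescaledCorrelator (criticalCorr 3)
        (fun δ : ℝ => (criticalTwoPoint 3 (Pi.single 0 (⌊1 / δ⌋ : ℤ))) ^ (-(1 / 2 : ℝ))) 2 δ
        (![0, EuclideanSpace.single 0 1] : Fin 2 → EuclideanSpace ℝ (Fin 3)) = 1 := by
  rw [rescaledCorrelator_apply, latticeApprox_comp_refPair, criticalCorr_two, pinnedGauge_sq]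
  exact inv_mul_cancel₀ (criticalTwoPoint_pinSite_pos δ).ne'

/-- **Ratio of the pinned gauge to any gauge.** If `(ρ, S)` is a pointwise scaling limit of
`criticalCorr 3` with `ρ > 0` on `(0,1]` and `S 2 x₀ > 0` at the reference pair `x₀ = (0, e₀)`, then
`ρ_pin(δ)/ρ(δ) → (S 2 x₀)^{-1/2}` as `δ → 0⁺` (`ρ(δ)² ⟨σ₀σ_{⌊1/δ⌋e₀}⟩ → S 2 x₀` is the limit read at
`x₀`). [folklore] -/
theorem tendsto_pinnedGauge_div {ρ : ℝ → ℝ} {S : CorrFamily 3} (hρ : ∀ δ ∈ Set.Ioc (0:ℝ) 1, 0 < ρ δ)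
    (hlim : HasPointwiseScalingLimit (criticalCorr 3) ρ S)
    (h0 : 0 < S 2 (![0, EuclideanSpace.single 0 1] : Fin 2 → EuclideanSpace ℝ (Fin 3))) :
    Tendsto (fun δ : ℝ =>
        (fun δ : ℝ => (criticalTwoPoint 3 (Pi.single 0 (⌊1 / δ⌋ : ℤ))) ^ (-(1 / 2 : ℝ))) δ / ρ δ)
      (𝓝[>] (0:ℝ))
      (𝓝 ((S 2 (![0, EuclideanSpace.single 0 1] : Fin 2 → EuclideanSpace ℝ (Fin 3))) ^ (-(1 / 2 : ℝ)))) := by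
  set a : ℝ := S 2 (![0, EuclideanSpace.single 0 1] : Fin 2 → EuclideanSpace ℝ (Fin 3)) with ha
  set ρp : ℝ → ℝ := fun δ : ℝ => (criticalTwoPoint 3 (Pi.single 0 (⌊1 / δ⌋ : ℤ))) ^ (-(1 / 2 : ℝ))
    with hρp
  -- the limit at the reference pair, rewritten through the axis two-point value
  have h1 : Tendsto (fun δ : ℝ => ρ δ ^ 2 * criticalTwoPoint 3 (Pi.single 0 (⌊1 / δ⌋ : ℤ))) (𝓝[>] 0)
      (𝓝 a) := by
    have h := (hlim 2).tendsto_at (zero_unitVec_mem_nonCoincident (t := (1:ℝ)) one_ne_zero)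
    refine h.congr fun δ => ?_
    rw [rescaledCorrelator_apply, latticeApprox_comp_refPair, criticalCorr_two]
  -- hence the square of the ratio converges to `a⁻¹`
  have hIoc : Set.Ioc (0:ℝ) 1 ∈ 𝓝[>] (0:ℝ) := Ioc_mem_nhdsGT one_pos
  have h2 : Tendsto (fun δ : ℝ => (ρp δ / ρ δ) ^ 2) (𝓝[>] 0) (𝓝 a⁻¹) := by
    refine (h1.inv₀ h0.ne').congr fun δ => ?_
    rw [div_pow, pinnedGauge_sq, mul_inv]
    ring
  -- and the (positive) ratio itself converges to the square root `√(a⁻¹) = a^{-1/2}`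
  have h3 := h2.sqrt
  have key : Real.sqrt a⁻¹ = a ^ (-(1 / 2 : ℝ)) := by
    rw [Real.sqrt_inv, Real.sqrt_eq_rpow, Real.rpow_neg h0.le]
  rw [key] at h3
  refine h3.congr' ?_
  filter_upwards [hIoc] with δ hδ
  exact Real.sqrt_sq (div_pos (pinnedGauge_pos δ) (hρ δ hδ)).le

/-- **Change to the pinned gauge.** If `(ρ, S)` is a non-degenerate pointwise scaling limit of the
critical `ℤ³` correlators (`ρ > 0` on `(0,1]`), then so is `(ρ_pin, S_pin)` with
`S_pin n x = ((S 2 x₀)^{-1/2})ⁿ · S n x`: the rescaled correlators in the two gauges differ by the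
configuration-independent factor `(ρ_pin/ρ)(δ)ⁿ → (S 2 x₀)^{-n/2}`, and `S n` is locally bounded on
non-coincident configurations (S3, `stub_limitLocallyBounded`). (Same statement, after `unfold rhoPin`,
as `hasPointwiseScalingLimit_rhoPin` of `…ExistsScaleCovariantLimit/Negative/PinnedForm.lean`, not imported
for cone hygiene.) [folklore; shape of ChelkakHonglerIzyurov2015 Thm 1.1] -/
theorem hasPointwiseScalingLimit_pinnedGauge {ρ : ℝ → ℝ} {S : CorrFamily 3}
    (hρ : ∀ δ ∈ Set.Ioc (0:ℝ) 1, 0 < ρ δ) (hlim : HasPointwiseScalingLimit (criticalCorr 3) ρ S)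
    (hnd : IsNondegenerateTwoPoint S) :
    HasPointwiseScalingLimit (criticalCorr 3)
      (fun δ : ℝ => (criticalTwoPoint 3 (Pi.single 0 (⌊1 / δ⌋ : ℤ))) ^ (-(1 / 2 : ℝ)))
      (fun n x => ((S 2 (![0, EuclideanSpace.single 0 1] : Fin 2 → EuclideanSpace ℝ (Fin 3))) ^
        (-(1 / 2 : ℝ))) ^ n * S n x) := by
  intro n
  have h0 : 0 < S 2 (![0, EuclideanSpace.single 0 1] : Fin 2 → EuclideanSpace ℝ (Fin 3)) :=
    hnd _ (zero_unitVec_mem_nonCoincident one_ne_zero)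
  set c : ℝ := (S 2 (![0, EuclideanSpace.single 0 1] : Fin 2 → EuclideanSpace ℝ (Fin 3))) ^
    (-(1 / 2 : ℝ)) with hc
  set ρp : ℝ → ℝ := fun δ : ℝ => (criticalTwoPoint 3 (Pi.single 0 (⌊1 / δ⌋ : ℤ))) ^ (-(1 / 2 : ℝ))
    with hρp
  have hratio : Tendsto (fun δ : ℝ => (ρp δ / ρ δ) ^ n) (𝓝[>] (0:ℝ)) (𝓝 (c ^ n)) :=
    (tendsto_pinnedGauge_div hρ hlim h0).pow n
  -- the constant-in-`x` factor converges uniformly, the rescaled correlators locally uniformly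
  have hF : TendstoLocallyUniformlyOn (fun (δ : ℝ) (_ : Fin n → EuclideanSpace ℝ (Fin 3)) =>
      (ρp δ / ρ δ) ^ n) (fun _ => c ^ n) (𝓝[>] (0:ℝ)) (NonCoincident 3 n) :=
    (hratio.tendstoUniformlyOn_const _).tendstoLocallyUniformlyOn
  have hprod := hF.mul₀_of_isBoundedUnder (hlim n) (fun x _ => isBoundedUnder_const)
    (fun x hx => by
      obtain ⟨C, hC⟩ := stub_limitLocallyBounded ρ S hlim n x hx
      exact ⟨C, (hC.filter_mono nhdsWithin_le_nhds).mono fun y hy => by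
        simpa [Real.dist_eq] using hy⟩)
  -- identify the limit and the sequence
  refine (hprod.congr_right fun x _ => rfl).congr_inseparable ?_
  have hIoc : Set.Ioc (0:ℝ) 1 ∈ 𝓝[>] (0:ℝ) := Ioc_mem_nhdsGT one_pos
  filter_upwards [hIoc] with δ hδ x _
  refine Inseparable.of_eq ?_
  have hρ0 : ρ δ ≠ 0 := (hρ δ hδ).ne'
  simp only [Pi.mul_apply, rescaledCorrelator_apply]
  rw [div_pow, ← mul_assoc, div_mul_cancel₀ _ (pow_ne_zero n hρ0)]

/-- The limit in the pinned gauge is non-degenerate. [folklore] -/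
theorem isNondegenerateTwoPoint_pinnedGaugeLimit {S : CorrFamily 3} (hnd : IsNondegenerateTwoPoint S) :
    IsNondegenerateTwoPoint (fun n x =>
      ((S 2 (![0, EuclideanSpace.single 0 1] : Fin 2 → EuclideanSpace ℝ (Fin 3))) ^ (-(1 / 2 : ℝ))) ^ n *
        S n x) := by
  intro x hx
  have h0 : 0 < S 2 (![0, EuclideanSpace.single 0 1] : Fin 2 → EuclideanSpace ℝ (Fin 3)) :=
    hnd _ (zero_unitVec_mem_nonCoincident one_ne_zero)
  exact mul_pos (pow_pos (Real.rpow_pos_of_pos h0 _) 2) (hnd x hx)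

/-- In the pinned gauge the limiting two-point function equals `1` at the reference pair
(`S_pin 2 x₀ = 1`): the gauge freedom of the crux is completely fixed. [folklore] -/
theorem pinnedGaugeLimit_two_refPair {S : CorrFamily 3} (hnd : IsNondegenerateTwoPoint S) :
    (fun n (x : Fin n → EuclideanSpace ℝ (Fin 3)) =>
        ((S 2 (![0, EuclideanSpace.single 0 1] : Fin 2 → EuclideanSpace ℝ (Fin 3))) ^ (-(1 / 2 : ℝ))) ^ n *
          S n x) 2 (![0, EuclideanSpace.single 0 1] : Fin 2 → EuclideanSpace ℝ (Fin 3)) = 1 := by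
  set a : ℝ := S 2 (![0, EuclideanSpace.single 0 1] : Fin 2 → EuclideanSpace ℝ (Fin 3)) with ha
  have h0 : 0 < a := hnd _ (zero_unitVec_mem_nonCoincident one_ne_zero)
  show (a ^ (-(1 / 2 : ℝ))) ^ 2 * a = 1
  rw [← Real.rpow_natCast, ← Real.rpow_mul h0.le]
  norm_num
  rw [Real.rpow_neg_one]
  exact inv_mul_cancel₀ h0.ne'

/-! ## §3 The lattice form of the crux -/

/-- **`LC_pin → ProxyUniversality`: the lattice comparison in the pinned gauge implies the crux.** If
there are row-wise profiles `J ≥ 0` and amplitudes `A > 0` such that for every even `n ≠ 0` the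
renormalised proxy correlators and the rescaled critical `ℤ³` correlators, both in the pinned gauge
`ρ_pin` and at the same mesh `δ_N = π/(N+1)`, differ by `o(1)` locally uniformly off the axis, then
`ProxyUniversality` holds: for a given limit pair `(ρ, S)` pass to `(ρ_pin, S_pin)`
(`hasPointwiseScalingLimit_pinnedGauge`), read the difference form backwards
(`tendstoLocallyUniformlyOn_proxyCorr_iff_sub`) and conclude by `ProxyUniversality_iff_evenLimit`.
[BrowerFlemingNeuberger2013 (the hypothesis being the typed lattice → lattice universality of radial
quantisation); folklore (the reduction)] -/
theorem ProxyUniversality_of_latticeComparison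
    (hL : ∃ (Jr Jt Jp : ℕ → ℕ → ℝ) (A : ℕ → ℝ → ℝ), (∀ N j, 0 ≤ Jr N j ∧ 0 ≤ Jt N j ∧ 0 ≤ Jp N j) ∧
      (∀ N θ, 0 < A N θ) ∧
      ∀ n : ℕ, Even n → n ≠ 0 →
        TendstoLocallyUniformlyOn
          (fun (N : ℕ) (p : Fin n → EuclideanSpace ℝ (Fin 3)) =>
            proxyCorr Jr Jt Jp A
                (fun δ : ℝ => (criticalTwoPoint 3 (Pi.single 0 (⌊1 / δ⌋ : ℤ))) ^ (-(1 / 2 : ℝ))) N n p -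
              rescaledCorrelator (criticalCorr 3)
                (fun δ : ℝ => (criticalTwoPoint 3 (Pi.single 0 (⌊1 / δ⌋ : ℤ))) ^ (-(1 / 2 : ℝ))) n
                (Real.pi / ((N : ℝ) + 1)) p)
          (fun _ => 0) atTop (offAxis n)) :
    ProxyUniversality := by
  refine ProxyUniversality_iff_evenLimit.2 fun ρ S hρ hlim hnd => ?_
  obtain ⟨Jr, Jt, Jp, A, hJ, hA, hconv⟩ := hL
  have hlim' := hasPointwiseScalingLimit_pinnedGauge hρ hlim hnd
  exact ⟨_, _, pinnedGauge_pos_Ioc, hlim', isNondegenerateTwoPoint_pinnedGaugeLimit hnd, Jr, Jt, Jp, A,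
    hJ, hA, fun n he hn0 => (tendstoLocallyUniformlyOn_proxyCorr_iff_sub hlim' n).2 (hconv n he hn0)⟩

/-- **THE LATTICE FORM OF THE CRUX.** `ProxyUniversality` holds iff the existence of a non-degenerate
pointwise scaling limit of the critical `ℤ³` correlators (in any gauge) implies the lattice comparison
`LC_pin` in the pinned gauge: profiles `J ≥ 0` and amplitudes `A > 0` such that for every even `n ≠ 0`,
`(∏ᵢ A_N(θᵢ) ρ_pin(δ_N‖pᵢ‖)) ⟨∏ᵢ σ_{v_N(pᵢ)}⟩_{proxy,N} − ρ_pin(δ_N)ⁿ ⟨∏ᵢ σ_{⌊pᵢ/δ_N⌋}⟩_{ℤ³,β_c} → 0`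
locally uniformly on injective off-axis configurations. The conclusion mentions no continuum object:
the open content of the crux is a comparison of two lattice models. (`→`: apply the crux to the pinned
limit pair `(ρ_pin, S_pin)` and subtract the restricted `ℤ³` limit; `←`:
`ProxyUniversality_of_latticeComparison`.) [BrowerFlemingNeuberger2013; folklore] -/
theorem ProxyUniversality_iff_latticeForm :
    ProxyUniversality ↔
      ((∃ (ρ : ℝ → ℝ) (S : CorrFamily 3), (∀ δ ∈ Set.Ioc (0:ℝ) 1, 0 < ρ δ) ∧
          HasPointwiseScalingLimit (criticalCorr 3) ρ S ∧ IsNondegenerateTwoPoint S) →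
        ∃ (Jr Jt Jp : ℕ → ℕ → ℝ) (A : ℕ → ℝ → ℝ), (∀ N j, 0 ≤ Jr N j ∧ 0 ≤ Jt N j ∧ 0 ≤ Jp N j) ∧
          (∀ N θ, 0 < A N θ) ∧
          ∀ n : ℕ, Even n → n ≠ 0 →
            TendstoLocallyUniformlyOn
              (fun (N : ℕ) (p : Fin n → EuclideanSpace ℝ (Fin 3)) =>
                proxyCorr Jr Jt Jp A
                    (fun δ : ℝ => (criticalTwoPoint 3 (Pi.single 0 (⌊1 / δ⌋ : ℤ))) ^ (-(1 / 2 : ℝ)))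
                    N n p -
                  rescaledCorrelator (criticalCorr 3)
                    (fun δ : ℝ => (criticalTwoPoint 3 (Pi.single 0 (⌊1 / δ⌋ : ℤ))) ^ (-(1 / 2 : ℝ))) n
                    (Real.pi / ((N : ℝ) + 1)) p)
              (fun _ => 0) atTop (offAxis n)) := by
  constructor
  · rintro h ⟨ρ, S, hρ, hlim, hnd⟩
    have hlim' := hasPointwiseScalingLimit_pinnedGauge hρ hlim hnd
    obtain ⟨Jr, Jt, Jp, A, hJ, hA, hconv⟩ := proxyUniversality_iff.1 h _ _ pinnedGauge_pos_Ioc hlim'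
      (isNondegenerateTwoPoint_pinnedGaugeLimit hnd)
    exact ⟨Jr, Jt, Jp, A, hJ, hA, fun n _ _ =>
      (tendstoLocallyUniformlyOn_proxyCorr_iff_sub hlim' n).1 (hconv n)⟩
  · intro h
    refine ProxyUniversality_iff_evenLimit.2 fun ρ S hρ hlim hnd => ?_
    obtain ⟨Jr, Jt, Jp, A, hJ, hA, hconv⟩ := h ⟨ρ, S, hρ, hlim, hnd⟩
    have hlim' := hasPointwiseScalingLimit_pinnedGauge hρ hlim hnd
    exact ⟨_, _, pinnedGauge_pos_Ioc, hlim', isNondegenerateTwoPoint_pinnedGaugeLimit hnd, Jr, Jt, Jp,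
      A, hJ, hA, fun n he hn0 => (tendstoLocallyUniformlyOn_proxyCorr_iff_sub hlim' n).2 (hconv n he hn0)⟩

end Summit.CriticalPhenomena.Ising3DConformalLimit.Cruxes.ProxyUniversality.Birth

end
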